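import Summits.FinalStateConjecture.FinalStateConjecture.Theorems.KerrShieldedDataExist.Negative.BentSliceConormal
import Literature.Geometry.Lorentzian.KerrHyperboloidalLeaves
import HarnessLib

/-!
# `KerrShieldedDataExist`, line `plug-the-second-sheet` — stub `stub_sliceClause`

The slice clause of crux `stmt-FinalStateConjecture-10055` at zero spin, with smooth exports (`stub_sliceClause`,
the case `a = 0` of `sliceClause_of_abs_lt`): for `M > 0`, (i) the literal bent height `T = Negative.bentHeight M a`
is `C^∞` on `ℝ` (`contDiff_bentHeight`: `T ≡ 0` on `r < 4M`, a product of smooth functions on `r > 3M ≥ r₊ + M`);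
(ii) the pinned graph `ψ = Negative.graph M a r₁ : y ↦ (T(r(0,y)), y)` (`= Kerr.leafEmbed a r₁ (T ∘ r) 0`,
`graph_eq_leafEmbed`) is a spacelike immersion `Kerr.slice a r₁ → (Kerr.region a r₁, g_{M,a})`; (iii) it carries
a future unit normal with a representative `N : E3 → E4` that is `C^∞` on the slice,
`N = (−g⁻¹(n,n))^{-1/2} · (−g♯n)`, `n = dt* − d(T∘r)` the leaf conormal (`Kerr.leafConormal`), `g♯ = Kerr.coSharp`.

§2 is generic: a graph leaf `y ↦ (τ + h(y), y)` of `Kerr.region a r₀` (any inner radius `r₀`; the tree's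
`Kerr.isSpacelikeImmersion_leafEmbed` is `r₀ = r₊`) whose conormal has negative `g⁻¹`-square is a spacelike
immersion, and `N` is its future unit normal (smooth on the slice) once `n(V) > 0`. §3 feeds it the bent height:
`g⁻¹(n,n) = conormalForm/Σ < 0` is the landed certificate `Negative.conormalForm_bentSlope_neg`, and
`n(V) = 1 + 2H(1 + T′) > 0`.

References: Dafermos–Rodnianski arXiv:0811.0354 §5.1; Cook, Living Rev. Relativ. 3 (2000) §3.2.2;
O'Neill 1983, Ch. 5 Lemma 5.26; Kerr–Schild 1965 §2.
-/

-- the doubled `FinalStateConjecture` path component is the summit/problem naming scheme, not a mistake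
set_option linter.dupNamespace false

noncomputable section

open Real Set Filter Topology
open scoped Manifold ContDiff Topology
open Literature.Geometry.Lorentzian
open Summit.FinalStateConjecture.FinalStateConjecture.Theorems.KerrShieldedDataExist

namespace Summit.FinalStateConjecture.FinalStateConjecture.Theorems.SwallowTheDatum

/-! ## §1 Smoothness of the hard-coded height -/

section Height

variable {M a : ℝ}

-- adapted from `contDiff_bentHeight` of the standing disprover's `Cruxes/KerrShieldedSettles/Disproof.lean`
/-- **The literal bent height `T_{M,a}` is `C^∞` on `ℝ`** for `0 < M` (any `a`): it vanishes identically on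
`(−∞, 4M)` (`Negative.bentHeight_eq_zero_of_le`) and is a product of smooth functions on `(3M, ∞)`, where
`r − r₊ > 0`, `r − r₋ > 0` (`r₋ ≤ r₊ ≤ 2M`) so both logarithms are smooth. [folklore] -/
theorem contDiff_bentHeight (hM : 0 < M) (a : ℝ) {n : ℕ∞} :
    ContDiff ℝ n (Negative.bentHeight M a) := by
  rw [← contDiffOn_univ]
  apply contDiffOn_of_locally_contDiffOn
  intro x _
  by_cases hx : x < 4 * M
  · refine ⟨Iio (4 * M), isOpen_Iio, hx, ?_⟩
    have : EqOn (Negative.bentHeight M a) (fun _ ↦ (0 : ℝ)) (univ ∩ Iio (4 * M)) := fun y hy ↦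
      Negative.bentHeight_eq_zero_of_le hM (le_of_lt hy.2)
    exact contDiffOn_const.congr this
  · refine ⟨Ioi (3 * M), isOpen_Ioi, ?_, ?_⟩
    · simp only [mem_Ioi]; linarith
    · have hP : Kerr.rPlus M a ≤ 2 * M := Kerr.rPlus_le_two_mul hM.le
      have hPM : Kerr.rMinus M a ≤ Kerr.rPlus M a := Kerr.rMinus_le_rPlus M a
      have hplus : ∀ y ∈ univ ∩ Ioi (3 * M), y - Kerr.rPlus M a ≠ 0 := fun y hy ↦ by
        have hy' : 3 * M < y := hy.2; exact sub_ne_zero.2 (by linarith)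
      have hminus : ∀ y ∈ univ ∩ Ioi (3 * M), y - Kerr.rMinus M a ≠ 0 := fun y hy ↦ by
        have hy' : 3 * M < y := hy.2; exact sub_ne_zero.2 (by linarith)
      have hF : ContDiffOn ℝ n (fun y ↦ Negative.blHeight M a y) (univ ∩ Ioi (3 * M)) := by
        unfold Negative.blHeight
        apply ContDiffOn.mul contDiffOn_const
        apply ContDiffOn.sub
        · exact ContDiffOn.mul contDiffOn_const ((contDiffOn_id.sub contDiffOn_const).log hplus)
        · exact ContDiffOn.mul contDiffOn_const ((contDiffOn_id.sub contDiffOn_const).log hminus)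
      have hχ : ContDiffOn ℝ n (fun y : ℝ ↦ Real.smoothTransition (y / (4 * M) - 1))
          (univ ∩ Ioi (3 * M)) :=
        (Real.smoothTransition.contDiff.comp ((contDiff_id.div_const _).sub contDiff_const)).contDiffOn
      exact hχ.mul (hF.sub contDiffOn_const)

/-- **The graph height `y ↦ T(r(0, y))` is `C^∞` on all of `E3`** (`0 < M`): near a point with `r < 4M` it
vanishes identically (`r` is continuous); at a point with `r ≥ 4M > 0` it is `T ∘ r` with `r` smooth off the
disc (`Kerr.contDiffAt_radius_slice`). [folklore] -/
theorem contDiff_bentHeight_radius (hM : 0 < M) (a : ℝ) :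
    ContDiff ℝ ∞ (fun y : E3 ↦ Negative.bentHeight M a (Kerr.radius a (E4.ofTimeSpace 0 y))) := by
  refine contDiff_iff_contDiffAt.2 fun y ↦ ?_
  rcases lt_or_ge (Kerr.radius a (E4.ofTimeSpace 0 y)) (4 * M) with hr | hr
  · have hopen : IsOpen {y : E3 | Kerr.radius a (E4.ofTimeSpace 0 y) < 4 * M} :=
      isOpen_lt ((Kerr.continuous_radius a).comp (E4.continuous_ofTimeSpace 0)) continuous_const
    have hev : (fun y : E3 ↦ Negative.bentHeight M a (Kerr.radius a (E4.ofTimeSpace 0 y))) =ᶠ[𝓝 y]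
        fun _ ↦ 0 := by
      filter_upwards [hopen.mem_nhds hr] with y' hy'
      exact Negative.bentHeight_eq_zero_of_le hM (le_of_lt hy')
    exact (contDiffAt_const (c := (0 : ℝ))).congr_of_eventuallyEq hev
  · have hr0 : 0 < Kerr.radius a (E4.ofTimeSpace 0 y) := by linarith
    exact (contDiff_bentHeight hM a).contDiffAt.comp y (Kerr.contDiffAt_radius_slice hr0)

/-- **The differential of the graph height is radial**: `d(T ∘ r)_y = T′(r) · dr` with `T′ = Negative.bentSlope`
(`Negative.hasDerivAt_bentHeight`, `Kerr.hasFDerivAt_radius_slice`), at every `y` off the disc. [folklore] -/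
theorem fderiv_bentHeight_radius (h : |a| < M) {y : E3} (hr : 0 < Kerr.radius a (E4.ofTimeSpace 0 y)) :
    fderiv ℝ (fun y : E3 ↦ Negative.bentHeight M a (Kerr.radius a (E4.ofTimeSpace 0 y))) y =
      Negative.bentSlope M a (Kerr.radius a (E4.ofTimeSpace 0 y)) • Kerr.radiusGrad a y :=
  ((Negative.hasDerivAt_bentHeight h _).comp_hasFDerivAt y (Kerr.hasFDerivAt_radius_slice hr)).fderiv

end Height

/-! ## §2 Graph leaves with negative conormal square: spacelike, with a smooth future unit normal -/

section Leaf

variable {M a r₀ τ : ℝ} {hgt : E3 → ℝ}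

/-- For a covector `p` at a point with `r > 0`, the rescaled dual `N = c • (−g♯p)` pairs with any `w` to
`g(N, w) = −c · p(w)` (`g(g♯p, w) = p(w)`, `Kerr.bilin_coSharp`). [cite: KerrSchild1965, §2] -/
theorem bilin_smul_neg_coSharp {x : E4} (hx : 0 < Kerr.radius a x) (c : ℝ) (p : E4 →ₗ[ℝ] ℝ) (w : E4) :
    Kerr.bilin M a x (c • -Kerr.coSharp M a x p) w = -(c * p w) := by
  rw [map_smul, _root_.smul_apply, map_neg, _root_.neg_apply, Kerr.bilin_coSharp M a hx, smul_eq_mul,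
    mul_neg]

/-- For a covector `p` with `q = g⁻¹(p, p) = p(g♯p) < 0` at a point with `r > 0`, the vector
`N = (√(−q))⁻¹ • (−g♯p)` is a unit timelike vector: `g(N, N) = q/(−q) = −1`. [cite: ONeill1983, Ch. 5 Lemma 5.26] -/
theorem bilin_unitCoSharp_self {x : E4} (hx : 0 < Kerr.radius a x) (p : E4 →ₗ[ℝ] ℝ)
    (hq : p (Kerr.coSharp M a x p) < 0) :
    Kerr.bilin M a x ((√(-p (Kerr.coSharp M a x p)))⁻¹ • -Kerr.coSharp M a x p)
      ((√(-p (Kerr.coSharp M a x p)))⁻¹ • -Kerr.coSharp M a x p) = -1 := by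
  set q := p (Kerr.coSharp M a x p) with hq_def
  have hs : √(-q) ^ 2 = -q := Real.sq_sqrt (by linarith)
  rw [bilin_smul_neg_coSharp hx, map_smul, map_neg, smul_eq_mul, ← hq_def]
  have h1 : (√(-q))⁻¹ * (√(-q))⁻¹ * -q = 1 := by
    rw [← mul_inv, ← sq, hs]
    exact inv_mul_cancel₀ (by linarith)
  linear_combination -h1

/-- **A graph leaf whose conormal has negative `g⁻¹`-square is a spacelike immersion** (any inner radius `r₀`;
the tree's `Kerr.isSpacelikeImmersion_leafEmbed` is the case `r₀ = r₊`): if `h` is `C^∞` at the slice points and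
`n(g♯n) < 0` for `n = dt* − dh` at every leaf point, then `W = −g♯n` is timelike, tangent vectors `w = (dh v, v)`
have `g(W, w) = −n(w) = 0` and are therefore spacelike (O'Neill 1983, Ch. 5, Lemma 5.26), nonzero for `v ≠ 0`.
[cite: ONeill1983, Ch. 5 Lemma 5.26] -/
theorem isSpacelikeImmersion_leafEmbed_of_neg [Kerr.Facts]
    (hh : ∀ y : Kerr.slice a r₀, ContDiffAt ℝ ∞ hgt (y : E3))
    (hq : ∀ y ∈ Kerr.slice a r₀, Kerr.leafConormal hgt (Kerr.leafPoint hgt τ y)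
      (Kerr.coSharp M a (Kerr.leafPoint hgt τ y) (Kerr.leafConormal hgt (Kerr.leafPoint hgt τ y))) < 0) :
    (Kerr.smoothMetric M a r₀).IsSpacelikeImmersion 𝓘(ℝ, E3) (Kerr.leafEmbed a r₀ hgt τ) := by
  refine ⟨Kerr.contMDiff_leafEmbed hh, fun y v hv ↦ ?_⟩
  have hd : HasFDerivAt hgt (fderiv ℝ hgt y) (y : E3) :=
    ((hh y).differentiableAt (by simp)).hasFDerivAt
  rw [PseudoRiemannianMetric.inducedBilin_apply, (Kerr.hasMFDerivAt_leafEmbed hd).mfderiv,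
    Kerr.smoothMetric_val]
  set x : Kerr.region a r₀ := Kerr.leafEmbed a r₀ hgt τ y with hx
  have hxr : 0 < Kerr.radius a x.1 := Kerr.radius_pos_of_mem_region x.2
  set w : E3 := v with hw
  have hw0 : w ≠ 0 := hv
  -- the leaf normal `W = −g♯n` is timelike
  have htl : (Kerr.smoothMetric M a r₀).IsTimelike (x := x)
      (-Kerr.coSharp M a x.1 (Kerr.leafConormal hgt x.1)) := by
    have key : Kerr.bilin M a x.1 (-Kerr.coSharp M a x.1 (Kerr.leafConormal hgt x.1))
        (-Kerr.coSharp M a x.1 (Kerr.leafConormal hgt x.1)) < 0 := by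
      rw [E4.bilin_neg_neg, Kerr.bilin_coSharp M a hxr]
      exact hq y y.2
    rw [LorentzianMetric.isTimelike_iff, Kerr.smoothMetric_val]
    exact key
  -- the tangent vector `(dh w, w)` is `g`-orthogonal to it
  have horth : Kerr.bilin M a x.1 (-Kerr.coSharp M a x.1 (Kerr.leafConormal hgt x.1))
      (E4.ofTimeSpace (fderiv ℝ hgt y w) w) = 0 := by
    rw [map_neg, _root_.neg_apply, Kerr.bilin_coSharp M a hxr, neg_eq_zero]
    exact Kerr.leafConormal_tangent hgt τ y w
  rcases (Kerr.smoothMetric M a r₀).isSpacelike_of_orthogonal htl horth with hpos | hzero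
  · have hgoal : 0 < Kerr.bilin M a x.1 (((fderiv ℝ hgt y).smulRight (E4.basisVector 0) + E4.spaceEmbed) w)
        (((fderiv ℝ hgt y).smulRight (E4.basisVector 0) + E4.spaceEmbed) w) := by
      rw [E4.smulRight_add_spaceEmbed_apply]; exact hpos
    exact hgoal
  · have h0 : E4.ofTimeSpace (fderiv ℝ hgt y w) w = (0 : E4) := hzero
    exact absurd (by simpa using congrArg E4.spatial h0) hw0

/-- **The normalised leaf normal is the future unit normal.** With `n = dt* − dh`, `q = n(g♯n) < 0` and
`n(V) > 0` (`V = −g♯dt*`) at every leaf point, `N = (√(−q))⁻¹ • (−g♯n)` along `y ↦ (τ + h y, y)` is normal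
(`g(N, (dh v, v)) = −(√(−q))⁻¹ n((dh v, v)) = 0`), unit timelike (`g(N, N) = −1`) and future-directed
(`g(V, N) = −(√(−q))⁻¹ n(V) < 0`). Cook 2000, §3.2.2 (the case `h = 0`: `N = (1 + 2H)^{-1/2} V`).
[cite: Cook2000, §3.2.2] -/
theorem isFutureUnitNormal_leafEmbed_of_neg [Kerr.Facts] (hM : 0 ≤ M)
    (hh : ∀ y : Kerr.slice a r₀, DifferentiableAt ℝ hgt (y : E3))
    (hq : ∀ y ∈ Kerr.slice a r₀, Kerr.leafConormal hgt (Kerr.leafPoint hgt τ y)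
      (Kerr.coSharp M a (Kerr.leafPoint hgt τ y) (Kerr.leafConormal hgt (Kerr.leafPoint hgt τ y))) < 0)
    (hV : ∀ y ∈ Kerr.slice a r₀, 0 < Kerr.leafConormal hgt (Kerr.leafPoint hgt τ y)
      (Kerr.timeVector M a (Kerr.leafPoint hgt τ y))) :
    (Kerr.smoothMetric M a r₀).IsFutureUnitNormal 𝓘(ℝ, E3) ((Kerr.timeOrientation M a r₀ hM).ofLE le_top)
      (Kerr.leafEmbed a r₀ hgt τ)
      (fun y ↦ (√(-Kerr.leafConormal hgt (Kerr.leafPoint hgt τ y)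
          (Kerr.coSharp M a (Kerr.leafPoint hgt τ y) (Kerr.leafConormal hgt (Kerr.leafPoint hgt τ y)))))⁻¹ •
        -Kerr.coSharp M a (Kerr.leafPoint hgt τ y) (Kerr.leafConormal hgt (Kerr.leafPoint hgt τ y))) := by
  have key : ∀ y : Kerr.slice a r₀, 0 < Kerr.radius a (Kerr.leafPoint hgt τ y) := fun y ↦
    Kerr.radius_pos_of_mem_region (Kerr.leafEmbed a r₀ hgt τ y).2
  refine ⟨⟨fun y v ↦ ?_, fun y ↦ ?_⟩, fun y ↦ ⟨LorentzianMetric.IsTimelike.isCausal _ ?_, ?_⟩⟩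
  · -- normal
    rw [(Kerr.hasMFDerivAt_leafEmbed (hh y).hasFDerivAt).mfderiv, Kerr.smoothMetric_val, Kerr.coe_leafEmbed]
    have h := bilin_smul_neg_coSharp (M := M) (key y)
      ((√(-Kerr.leafConormal hgt (Kerr.leafPoint hgt τ y)
          (Kerr.coSharp M a (Kerr.leafPoint hgt τ y) (Kerr.leafConormal hgt (Kerr.leafPoint hgt τ y)))))⁻¹)
      (Kerr.leafConormal hgt (Kerr.leafPoint hgt τ y)) (E4.ofTimeSpace (fderiv ℝ hgt y v) v)
    rw [Kerr.leafConormal_tangent hgt τ y v, mul_zero, neg_zero, ← E4.smulRight_add_spaceEmbed_apply] at h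
    exact h
  · -- unit
    rw [Kerr.smoothMetric_val, Kerr.coe_leafEmbed]
    exact bilin_unitCoSharp_self (key y) _ (hq y y.2)
  · -- timelike, hence causal
    rw [LorentzianMetric.isTimelike_iff, Kerr.smoothMetric_val, Kerr.coe_leafEmbed]
    exact (bilin_unitCoSharp_self (key y) _ (hq y y.2)).trans_lt (by norm_num)
  · -- future
    rw [TimeOrientation.vectorField_ofLE, Kerr.smoothMetric_val, Kerr.coe_leafEmbed]
    change Kerr.bilin M a (Kerr.leafPoint hgt τ y) (Kerr.timeVector M a (Kerr.leafPoint hgt τ y)) _ < 0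
    rw [Kerr.bilin_symm, bilin_smul_neg_coSharp (key y)]
    exact neg_neg_of_pos (mul_pos (inv_pos.2 (Real.sqrt_pos.2 (neg_pos.2 (hq y y.2)))) (hV y y.2))

/-! ### Smoothness of the normalised leaf normal -/

/-- The leaf map `y ↦ (τ + h y, y) = (τ + h y) ∂₀ + (0, y)` is `C^∞` on `E3` when `h` is. [folklore] -/
theorem contDiff_leafPoint (hh : ContDiff ℝ ∞ hgt) (τ : ℝ) : ContDiff ℝ ∞ (Kerr.leafPoint hgt τ) := by
  have : Kerr.leafPoint hgt τ = fun y ↦ (τ + hgt y) • E4.basisVector 0 + E4.spaceEmbed y :=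
    funext fun y ↦ E4.ofTimeSpace_eq_smul_add' _ _
  rw [this]
  exact ((contDiff_const.add hh).smul contDiff_const).add E4.spaceEmbed.contDiff

/-- `y ↦ n_y(w(y)) = w(y)⁰ − dh_y(w⃗(y))` is `C^∞` at `y` when `h` is `C^∞` (so `y ↦ dh_y` is) and the vector
field `w` is `C^∞` at `y`. [folklore] -/
theorem contDiffAt_leafConormal_apply (hh : ContDiff ℝ ∞ hgt) {w : E3 → E4} {y : E3}
    (hw : ContDiffAt ℝ ∞ w y) :
    ContDiffAt ℝ ∞ (fun y ↦ Kerr.leafConormal hgt (Kerr.leafPoint hgt τ y) (w y)) y := by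
  have hΦ : ContDiff ℝ ∞ (fderiv ℝ hgt) := hh.fderiv_right (m := ∞) le_rfl
  simp_rw [Kerr.leafConormal_apply, Kerr.leafPoint, E4.spatial_ofTimeSpace]
  exact (contDiffAt_euclidean.1 hw 0).sub (hΦ.contDiffAt.clm_apply (hw.continuousLinearMap_comp E4.spatial))

/-- `y ↦ η♯ n_y` is `C^∞` (componentwise `∓ n_y(∂_μ)`). [folklore] -/
theorem contDiffAt_etaSharp_leafConormal (hh : ContDiff ℝ ∞ hgt) (y : E3) :
    ContDiffAt ℝ ∞ (fun y ↦ Kerr.etaSharp (Kerr.leafConormal hgt (Kerr.leafPoint hgt τ y))) y := by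
  rw [contDiffAt_euclidean]
  intro μ
  by_cases hμ : μ = 0
  · subst hμ
    simp only [Kerr.etaSharp_apply_zero]
    exact (contDiffAt_leafConormal_apply hh contDiffAt_const).neg
  · have : (fun y ↦ Kerr.etaSharp (Kerr.leafConormal hgt (Kerr.leafPoint hgt τ y)) μ) =
        fun y ↦ Kerr.leafConormal hgt (Kerr.leafPoint hgt τ y) (E4.basisVector μ) := by
      funext y
      rw [Kerr.etaSharp, PiLp.toLp_apply, if_neg hμ]
    rw [this]
    exact contDiffAt_leafConormal_apply hh contDiffAt_const

/-- `y ↦ g♯ n_y = η♯ n_y − 2H n_y(ℓ♯) ℓ♯` (`Kerr.coSharp` of the leaf conormal) is `C^∞` at every `y` whose leaf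
point has `r > 0` (`Kerr.contDiffAt_scalarH`, `Kerr.contDiffAt_nullVector`). [cite: KerrSchild1965, §2] -/
theorem contDiffAt_coSharp_leafConormal (hh : ContDiff ℝ ∞ hgt) {y : E3}
    (hr : 0 < Kerr.radius a (Kerr.leafPoint hgt τ y)) :
    ContDiffAt ℝ ∞ (fun y ↦ Kerr.coSharp M a (Kerr.leafPoint hgt τ y)
      (Kerr.leafConormal hgt (Kerr.leafPoint hgt τ y))) y := by
  have hX := (contDiff_leafPoint hh τ).contDiffAt (x := y)
  have hH : ContDiffAt ℝ ∞ (fun y ↦ Kerr.scalarH M a (Kerr.leafPoint hgt τ y)) y :=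
    (Kerr.contDiffAt_scalarH M a hr).comp y hX
  have hL : ContDiffAt ℝ ∞ (fun y ↦ Kerr.nullVector a (Kerr.leafPoint hgt τ y)) y :=
    (Kerr.contDiffAt_nullVector a hr).comp y hX
  unfold Kerr.coSharp
  exact (contDiffAt_etaSharp_leafConormal hh y).sub
    (((contDiffAt_const.mul hH).mul (contDiffAt_leafConormal_apply hh hL)).smul hL)

/-- **The normalised leaf normal `N = (√(−q))⁻¹ • (−g♯n)` is `C^∞` on the slice** `Kerr.slice a r₀` when `h`
is `C^∞` and `q = n(g♯n) < 0` there (`√` and `⁻¹` are smooth off `0`). [folklore] -/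
theorem contDiffOn_leafUnitNormal (hh : ContDiff ℝ ∞ hgt)
    (hq : ∀ y ∈ Kerr.slice a r₀, Kerr.leafConormal hgt (Kerr.leafPoint hgt τ y)
      (Kerr.coSharp M a (Kerr.leafPoint hgt τ y) (Kerr.leafConormal hgt (Kerr.leafPoint hgt τ y))) < 0) :
    ContDiffOn ℝ ∞ (fun y ↦ (√(-Kerr.leafConormal hgt (Kerr.leafPoint hgt τ y)
          (Kerr.coSharp M a (Kerr.leafPoint hgt τ y) (Kerr.leafConormal hgt (Kerr.leafPoint hgt τ y)))))⁻¹ •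
        -Kerr.coSharp M a (Kerr.leafPoint hgt τ y) (Kerr.leafConormal hgt (Kerr.leafPoint hgt τ y)))
      (Kerr.slice a r₀ : Set E3) := by
  intro y hy
  have hr : 0 < Kerr.radius a (Kerr.leafPoint hgt τ y) :=
    Kerr.radius_pos_of_mem_region (Kerr.leafEmbed a r₀ hgt τ ⟨y, hy⟩).2
  have hC := contDiffAt_coSharp_leafConormal (M := M) hh hr
  have hQ := contDiffAt_leafConormal_apply (τ := τ) hh hC
  have hq0 : -Kerr.leafConormal hgt (Kerr.leafPoint hgt τ y)
      (Kerr.coSharp M a (Kerr.leafPoint hgt τ y) (Kerr.leafConormal hgt (Kerr.leafPoint hgt τ y))) ≠ 0 :=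
    (neg_pos.2 (hq y hy)).ne'
  have hs0 : √(-Kerr.leafConormal hgt (Kerr.leafPoint hgt τ y)
      (Kerr.coSharp M a (Kerr.leafPoint hgt τ y) (Kerr.leafConormal hgt (Kerr.leafPoint hgt τ y)))) ≠ 0 :=
    (Real.sqrt_pos.2 (neg_pos.2 (hq y hy))).ne'
  exact (((hQ.neg.sqrt hq0).inv hs0).smul hC.neg).contDiffWithinAt

/-- **Packaging**: a smooth height whose leaf conormal has negative `g⁻¹`-square and pairs positively with `V`
yields a representative `N : E3 → E4`, `C^∞` on the slice, of the future unit normal of the leaf. [cite: Cook2000, §3.2.2] -/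
theorem exists_smooth_futureUnitNormal_leafEmbed [Kerr.Facts] (hM : 0 ≤ M) (hh : ContDiff ℝ ∞ hgt)
    (hq : ∀ y ∈ Kerr.slice a r₀, Kerr.leafConormal hgt (Kerr.leafPoint hgt τ y)
      (Kerr.coSharp M a (Kerr.leafPoint hgt τ y) (Kerr.leafConormal hgt (Kerr.leafPoint hgt τ y))) < 0)
    (hV : ∀ y ∈ Kerr.slice a r₀, 0 < Kerr.leafConormal hgt (Kerr.leafPoint hgt τ y)
      (Kerr.timeVector M a (Kerr.leafPoint hgt τ y))) :
    ∃ N : E3 → E4, ContDiffOn ℝ ∞ N (Kerr.slice a r₀ : Set E3) ∧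
      (Kerr.smoothMetric M a r₀).IsFutureUnitNormal 𝓘(ℝ, E3) ((Kerr.timeOrientation M a r₀ hM).ofLE le_top)
        (Kerr.leafEmbed a r₀ hgt τ) (fun y ↦ N y) :=
  ⟨_, contDiffOn_leafUnitNormal hh hq,
    isFutureUnitNormal_leafEmbed_of_neg hM (fun y ↦ (hh.differentiable (by simp)).differentiableAt) hq hV⟩

end Leaf

/-! ## §3 The bent leaf: conormal square and time pairing -/

section Bent

variable {M a r₁ : ℝ}

/-- **`g⁻¹(n, n) = conormalForm/Σ < 0` for the bent leaf.** At the leaf point over `y` (radius `r > 0`, `z = y₂`)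
the conormal `n = dt* − T′(r) dr` has `n(g♯n) = Negative.conormalForm M a r (z/r) (T′(r)) / Σ`, `Σ = r² + a²z²/r²`
(`Kerr.leafConormal_coSharp_of_radial`, `Kerr.sq_mul_blSigma`), negative for `|a| < M` by the landed certificate
`Negative.conormalForm_bentSlope_neg`. [cite: arXiv08110354, §5.1] -/
theorem leafConormal_coSharp_bent_neg (h : |a| < M) (τ : ℝ) {y : E3} (hr : 0 < Kerr.radius a (E4.ofTimeSpace 0 y)) :
    Kerr.leafConormal (fun y : E3 ↦ Negative.bentHeight M a (Kerr.radius a (E4.ofTimeSpace 0 y)))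
        (Kerr.leafPoint (fun y : E3 ↦ Negative.bentHeight M a (Kerr.radius a (E4.ofTimeSpace 0 y))) τ y)
      (Kerr.coSharp M a
        (Kerr.leafPoint (fun y : E3 ↦ Negative.bentHeight M a (Kerr.radius a (E4.ofTimeSpace 0 y))) τ y)
        (Kerr.leafConormal (fun y : E3 ↦ Negative.bentHeight M a (Kerr.radius a (E4.ofTimeSpace 0 y)))
          (Kerr.leafPoint (fun y : E3 ↦ Negative.bentHeight M a (Kerr.radius a (E4.ofTimeSpace 0 y))) τ y))) < 0 := by
  rw [Kerr.leafPoint, Kerr.leafConormal_coSharp_of_radial (fderiv_bentHeight_radius h hr) hr]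
  have hS := Kerr.blSigma_pos hr
  refine div_neg_of_neg_of_pos ?_ hS
  set r := Kerr.radius a (E4.ofTimeSpace 0 y) with hr_def
  have hSig : Kerr.blSigma a y = r ^ 2 + a ^ 2 * (y 2 / r) ^ 2 := by
    have hq := Kerr.sq_mul_blSigma a y
    rw [← hr_def] at hq
    have hr2 : r ^ 2 ≠ 0 := pow_ne_zero 2 hr.ne'
    field_simp
    linear_combination hq
  have key := Negative.conormalForm_bentSlope_neg h hr (y 2 / r)
  unfold Negative.conormalForm at key
  rw [hSig]
  linarith

/-- **`n(V) = 1 + 2H(1 + T′) > 0` for the bent leaf** (`Kerr.leafConormal_timeVector_of_radial`; `H ≥ 0` for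
`0 ≤ M`, `T′ = Negative.bentSlope ≥ 0`): the leaf normal `−g♯n` lies in the time cone of `V = −g♯dt*`.
[cite: arXiv08110354, §5.1] -/
theorem leafConormal_timeVector_bent_pos (h : |a| < M) (τ : ℝ) {y : E3}
    (hr : 0 < Kerr.radius a (E4.ofTimeSpace 0 y)) :
    0 < Kerr.leafConormal (fun y : E3 ↦ Negative.bentHeight M a (Kerr.radius a (E4.ofTimeSpace 0 y)))
        (Kerr.leafPoint (fun y : E3 ↦ Negative.bentHeight M a (Kerr.radius a (E4.ofTimeSpace 0 y))) τ y)
      (Kerr.timeVector M a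
        (Kerr.leafPoint (fun y : E3 ↦ Negative.bentHeight M a (Kerr.radius a (E4.ofTimeSpace 0 y))) τ y)) := by
  rw [Kerr.leafPoint, Kerr.leafConormal_timeVector_of_radial (fderiv_bentHeight_radius h hr) hr]
  have hH := Kerr.scalarH_nonneg (Negative.mass_pos h).le a
    (E4.ofTimeSpace (τ + Negative.bentHeight M a (Kerr.radius a (E4.ofTimeSpace 0 y))) y)
  have hc := Negative.bentSlope_nonneg h (Kerr.radius a (E4.ofTimeSpace 0 y))
  positivity

/-- The crux's pinned immersion is the leaf embedding of the graph height at `τ = 0`: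
`Negative.graph M a r₁ = Kerr.leafEmbed a r₁ (T ∘ r) 0` (`(T(r), y) = (0 + T(r), y)`). [folklore] -/
theorem graph_eq_leafEmbed (M a r₁ : ℝ) :
    Negative.graph M a r₁ =
      Kerr.leafEmbed a r₁ (fun y : E3 ↦ Negative.bentHeight M a (Kerr.radius a (E4.ofTimeSpace 0 y))) 0 := by
  funext y
  apply Subtype.ext
  rw [Negative.coe_graph, Kerr.coe_leafEmbed, zero_add]

/-- **The slice clause for every sub-extremal spin.** For `|a| < M`, `0 ≤ M` and any junction radius `r₁`:
the bent height is `C^∞`, the pinned graph `Negative.graph M a r₁` is a spacelike immersion of `Kerr.slice a r₁`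
into `(Kerr.region a r₁, g_{M,a})`, and it carries a future unit normal with a representative `C^∞` on the slice.
[cite: arXiv08110354, §5.1] -/
theorem sliceClause_of_abs_lt [Kerr.Facts] (h : |a| < M) (hM : 0 ≤ M) (r₁ : ℝ) :
    ContDiff ℝ ∞ (Negative.bentHeight M a) ∧
      (Kerr.smoothMetric M a r₁).IsSpacelikeImmersion 𝓘(ℝ, E3) (Negative.graph M a r₁) ∧
      ∃ N : E3 → E4, ContDiffOn ℝ ∞ N (Kerr.slice a r₁ : Set E3) ∧
        (Kerr.smoothMetric M a r₁).IsFutureUnitNormal 𝓘(ℝ, E3) ((Kerr.timeOrientation M a r₁ hM).ofLE le_top)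
          (Negative.graph M a r₁) (fun y ↦ N y) := by
  have hM0 := Negative.mass_pos h
  have hh := contDiff_bentHeight_radius hM0 a
  have hr : ∀ y ∈ Kerr.slice a r₁, 0 < Kerr.radius a (E4.ofTimeSpace 0 y) := fun y hy ↦
    Kerr.radius_pos_of_mem_region (Kerr.mem_slice_iff_ofTimeSpace_mem_region.1 hy)
  refine ⟨contDiff_bentHeight hM0 a, ?_, ?_⟩
  · rw [graph_eq_leafEmbed]
    exact isSpacelikeImmersion_leafEmbed_of_neg (fun y ↦ hh.contDiffAt)
      (fun y hy ↦ leafConormal_coSharp_bent_neg h 0 (hr y hy))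
  · rw [graph_eq_leafEmbed]
    exact exists_smooth_futureUnitNormal_leafEmbed hM hh
      (fun y hy ↦ leafConormal_coSharp_bent_neg h 0 (hr y hy))
      (fun y hy ↦ leafConormal_timeVector_bent_pos h 0 (hr y hy))

/-- **Stub `stub_sliceClause` of line `plug-the-second-sheet` (crux `stmt-FinalStateConjecture-10055`): the slice
clause at zero spin, with smooth exports.** For `M > 0`, `r₁ > 0`: (i) `Negative.bentHeight M 0` is `C^∞` on `ℝ`;
(ii) the pinned graph `ψ = Negative.graph M 0 r₁` (`y ↦ (T(‖y‖), y)`) is a spacelike immersion of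
`Kerr.slice 0 r₁ = {‖y‖ > r₁}` into `(Kerr.region 0 r₁, g_{M,0})`; (iii) it carries a future unit normal for
`V = −g♯dt*` with a representative `N : E3 → E4` smooth on the slice (`N = (−g⁻¹(n,n))^{-1/2} (−g♯n)`,
`n = dt* − T′(r) dr`). The case `a = 0` of `sliceClause_of_abs_lt`. [cite: arXiv08110354, §5.1] -/
theorem stub_sliceClause :
    ∀ [Kerr.Facts] (M r₁ : ℝ) (hM : 0 ≤ M), 0 < M → 0 < r₁ →
      ContDiff ℝ ∞ (Negative.bentHeight M 0) ∧
      (Kerr.smoothMetric M 0 r₁).IsSpacelikeImmersion 𝓘(ℝ, E3) (Negative.graph M 0 r₁) ∧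
      ∃ N : E3 → E4, ContDiffOn ℝ ∞ N (Kerr.slice 0 r₁ : Set E3) ∧
        (Kerr.smoothMetric M 0 r₁).IsFutureUnitNormal 𝓘(ℝ, E3) ((Kerr.timeOrientation M 0 r₁ hM).ofLE le_top)
          (Negative.graph M 0 r₁) (fun y ↦ N y) := by
  intro _ M r₁ hM hM0 _
  have h0 : |(0 : ℝ)| < M := by rwa [abs_zero]
  exact sliceClause_of_abs_lt h0 hM r₁

end Bent

end Summit.FinalStateConjecture.FinalStateConjecture.Theorems.SwallowTheDatum

end
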